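import Literature.AlgebraicGeometry.Resolution.BlowupStalkCharts
import Literature.AlgebraicGeometry.Resolution.BlowupAlgebraPresentation
import Literature.AlgebraicGeometry.Resolution.StalkIdealLemmas
import Literature.AlgebraicGeometry.Resolution.IdealSheafLemmas
import HarnessLib

/-!
# [OURS · L1 W4.5(b) · EL♮] T-PTPRIME-DICT (1/2): every prime of a chart algebra `𝒪_{X,s}[J_s/c_j]` over `𝔪_s` is a point of
# the blowing up — WITH its compatible chart presentation, and the prime is determined by the point and the chart

Crux `EquisingularLiftNat` = stmt-ResolutionOfSingularities-20038 (route EquisingularLift), registered stub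
`stub_elnat_tcDeltaPointResolution` (any `n`); helper file `--supports stmt-ResolutionOfSingularities-20038 --as helper`. Object
T-PTPRIME-DICT named by res-L1-w45b-lead-2 (STATUS 2026-08-27T09:31:41Z; res-type-100 09:30:25Z (B)): the CONVERSE of the
point ↦ chart-prime dictionary `exists_blowupAlgebra_stalk_ringEquiv` (p506193) / `IsBlowup.exists_reesChart_stalk`, in a form that
transports chart-level conditions «at every prime of the chart algebra» to «at every point of the blowing up» AND BACK — needed to
turn «finitely many non-regular points of the reduced exceptional trace» into res-type-032's per-chart finiteness hypothesis `hfin` of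
`exists_isHomogeneous_lift_deltaRegular` (p-file …NatDeltaConeLift). HONEST FRAMING: OURS (cell res-hironaka, slot W4.5(b)); NOT a
statement of any manuscript; Stacks 0804/0805 bookkeeping. AI-written, weaker than expert review. No `sorry`; standard axioms.

## Content (namespace `…Cruxes.EquisingularLiftNat.Sections`) — ANY blowing up `π : X' → X` (`IsBlowup π J`), any scheme `X`

* `exists_point_presentation_of_blowupAlgebra_prime` — for `s ∈ X`, generators `c` of `J_s`, a chart index `j` and a prime `𝔔` of
  `𝒪_{X,s}[J_s/c_j]` over `𝔪_s`: a point `x' ∈ X'` with `π x' = s`, a ring map `χ : 𝒪_{X,s}[J_s/c_j] → 𝒪_{X',x'}` extending `π^♯_{x'}`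
  (read through the canonical identification `𝒪_{X,s} ≅ 𝒪_{X,π x'}` of the stalks at equal points) and a ring isomorphism
  `𝒪_{X',x'} ≅ (𝒪_{X,s}[J_s/c_j])_𝔔` sending `χ b ↦ b/1` — the tree's `IsBlowup.exists_point_of_blowupAlgebra_prime`
  (`BlowupAlgebraPrimesPoints.lean`, a bare isomorphism) with the compatibilities kept.
* `chartPrime_eq_of_presentations` — **in a fixed chart the prime is determined by the point**: two presentations
  `(j, 𝔔₁, χ₁)`, `(j, 𝔔₂, χ₂)` of the same local ring `𝒪_{X',x'}` that agree on `𝒪_{X,s}` have `𝔔₁ = 𝔔₂` (the exceptional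
  generator `c_j` is a non-zero-divisor at `x'`, the exceptional divisor being effective Cartier, so `χ₁ = χ₂` on the fractions
  `c_l/c_j`, hence everywhere; and `𝔔ᵢ = χᵢ⁻¹ 𝔪_{x'}`). Hence the map «prime over `𝔪_s` in chart `j` ↦ point of `π⁻¹ s`» is injective.

References: The Stacks Project, Tags 0804, 0805, 07Z3 — through `BlowupStalkCharts.lean`, `BlowupAlgebraPrimesPoints.lean`,
`BlowupAlgebraPresentation.lean`; p506193 (…CampaignW45bBlowupStalkDictionary).
-/

set_option linter.dupNamespace false -- mandated namespace `Summit.<Summit>.<Problem>` of this single-conjunct summit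

noncomputable section

open CategoryTheory CategoryTheory.Limits AlgebraicGeometry TopologicalSpace IsLocalRing HomogeneousLocalization
open Literature.AlgebraicGeometry.Resolution
open AlgebraicGeometry.Scheme.IdealSheafData

namespace Summit.ResolutionOfSingularities.ResolutionOfSingularities.Cruxes.EquisingularLiftNat.Sections

universe u

variable {X' X : Scheme.{u}} {π : X' ⟶ X} {J : X.IdealSheafData}

set_option maxHeartbeats 800000 in
-- the comparison with `Proj` over `Spec 𝒪_{X,s}` elaborates large terms (as in `IsBlowup.exists_chart_morphism`)
/-- **Every prime of `𝒪_{X,s}[J_s/c_j]` over `𝔪_s` is the local ring of a point of the blowing up over `s`, compatibly.** Let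
`π : X' → X` be a blowing up along `J`, `s ∈ X`, `c₁, …, c_k ∈ 𝒪_{X,s}` generators of `J_s`, `j` a chart index and `𝔔` a prime
of the affine blowup algebra `𝒪_{X,s}[J_s/c_j]` with `𝔔 ∩ 𝒪_{X,s} = 𝔪_s`. Then there are `x' ∈ X'` with `π x' = s`, a ring map
`χ : 𝒪_{X,s}[J_s/c_j] → 𝒪_{X',x'}` with `χ (a/1) = π^♯_{x'} a` (through `𝒪_{X,s} ≅ 𝒪_{X,π x'}`), and a ring isomorphism
`e : 𝒪_{X',x'} ≅ (𝒪_{X,s}[J_s/c_j])_𝔔` with `e (χ b) = b/1`. [cite: StacksProject, Tag 0804; StacksProject, Tag 0805] -/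
theorem exists_point_presentation_of_blowupAlgebra_prime (hπ : IsBlowup π J) (s : X) {k : ℕ}
    (c : Fin k → X.presheaf.stalk s) (hc : Ideal.span (Set.range c) = stalkIdeal J s) (j : Fin k)
    (𝔔 : PrimeSpectrum (blowupAlgebra (Ideal.span (Set.range c)) (c j)))
    (h𝔔 : 𝔔.asIdeal.comap (algebraMap _ (blowupAlgebra (Ideal.span (Set.range c)) (c j))) =
      maximalIdeal (X.presheaf.stalk s)) :
    ∃ (x' : X') (hx : π x' = s) (χ : blowupAlgebra (Ideal.span (Set.range c)) (c j) →+* X'.presheaf.stalk x')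
      (e : X'.presheaf.stalk x' ≃+* Localization.AtPrime 𝔔.asIdeal),
      (∀ a, χ (algebraMap _ _ a) = (π.stalkMap x').hom ((X.presheaf.stalkCongr (.of_eq hx.symm)).hom a)) ∧
      (∀ b, e (χ b) = algebraMap _ (Localization.AtPrime 𝔔.asIdeal) b) := by
  classical
  have hcj : ∀ j, c j ∈ Ideal.span (Set.range c) := fun j =>
    Ideal.mem_span_range_self (f := c) (x := j)
  haveI : Flat (X.fromSpecStalk s) := flat_fromSpecStalk X s
  -- the base change `P = X' ×_X Spec 𝒪_{X,s} → Spec 𝒪_{X,s}` is a blowing up along `(J_s)~ = (c)~`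
  have hP : IsBlowup (pullback.snd π (X.fromSpecStalk s))
      (affineBlowup.idealSheaf (Ideal.span (Set.range c))) := by
    have h := hπ.pullback_snd_of_flat (X.fromSpecStalk s)
    rwa [comap_fromSpecStalk_eq_affineBlowupIdealSheaf, ← hc] at h
  obtain ⟨eP, heP, -⟩ := (affineBlowup.isBlowup (Ideal.span (Set.range c))).unique hP
  -- the chart isomorphism `ε : B_j ≃ 𝒪_{X,s}[(c)/c_j]` and the point `w = ε⁻¹ 𝔔` of `Spec B_j`
  set ε : chartRing c j ≃+* blowupAlgebra (Ideal.span (Set.range c)) (c j) :=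
    reesChartEquiv (I := Ideal.span (Set.range c)) (c j) (hcj j) with hεdef
  have hε : ∀ a, ε (chartBase c j a) = algebraMap _ (blowupAlgebra (Ideal.span (Set.range c)) (c j)) a :=
    reesChartEquiv_reesChartBase (c j) _
  let w : Spec (.of (chartRing c j)) :=
    ⟨𝔔.asIdeal.comap (ε : chartRing c j →+* _), Ideal.comap_isPrime (ε : chartRing c j →+* _) 𝔔.asIdeal⟩
  have hmemw : ∀ b : chartRing c j, ε b ∈ 𝔔.asIdeal ↔ b ∈ w.asIdeal := fun b => Iff.rfl
  have hw : (Spec.map (CommRingCat.ofHom (chartBase c j))).base w = closedPoint (X.presheaf.stalk s) := by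
    rw [Spec.map_base]
    change PrimeSpectrum.comap (chartBase c j) w = closedPoint (X.presheaf.stalk s)
    ext a
    change chartBase c j a ∈ w.asIdeal ↔ a ∈ (closedPoint (X.presheaf.stalk s)).asIdeal
    rw [← hmemw, hε, show (closedPoint (X.presheaf.stalk s)).asIdeal = maximalIdeal _ from rfl, ← h𝔔,
      Ideal.mem_comap]
  -- the chart morphism `q : Spec B_j → Proj ≅ P → X'` and the point `x' = q w`
  let q : Spec (.of (chartRing c j)) ⟶ X' :=
    (affineBlowup.chartι (c j) (hcj j) ≫ eP.hom) ≫ pullback.fst π (X.fromSpecStalk s)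
  have hqπ : q ≫ π = Spec.map (CommRingCat.ofHom (chartBase c j)) ≫ X.fromSpecStalk s := by
    rw [Category.assoc, pullback.condition, Category.assoc, reassoc_of% heP, ← Category.assoc,
      affineBlowup.chartι_π (c j) (hcj j)]
  have hx : π (q w) = s := by
    have h1 : π (q w) = (q ≫ π) w := (Scheme.Hom.comp_apply q π w).symm
    rw [h1, hqπ, Scheme.Hom.comp_apply, hw, Scheme.fromSpecStalk_closedPoint]
  -- `q` is an isomorphism on local rings at `w`
  haveI : IsIso (q.stalkMap w) := by
    have h1 := isIso_stalkMap_pullback_fst_fromSpecStalk π s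
      ((affineBlowup.chartι (c j) (hcj j) ≫ eP.hom) w)
    haveI : IsOpenImmersion (affineBlowup.chartι (c j) (hcj j) ≫ eP.hom) := inferInstance
    have h2 : IsIso ((affineBlowup.chartι (c j) (hcj j) ≫ eP.hom).stalkMap w) := inferInstance
    change IsIso (((affineBlowup.chartι (c j) (hcj j) ≫ eP.hom) ≫ pullback.fst π (X.fromSpecStalk s)).stalkMap w)
    rw [Scheme.Hom.stalkMap_comp]
    exact @IsIso.comp_isIso _ _ _ _ _ _ _ h1 h2
  -- the structure map read at `π x'`: `φ' = (𝒪_{X,π x'} ≅ 𝒪_{X,s}) ≫ chartBase`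
  let ι₁ : X.presheaf.stalk (π (q w)) ⟶ X.presheaf.stalk s := (X.presheaf.stalkCongr (.of_eq hx)).hom
  let φ' : X.presheaf.stalk (π (q w)) ⟶ CommRingCat.of (chartRing c j) := ι₁ ≫ CommRingCat.ofHom (chartBase c j)
  have hsq : q ≫ π = Spec.map φ' ≫ X.fromSpecStalk (π (q w)) := by
    rw [hqπ, Spec.map_comp, Category.assoc]
    congr 1
    change X.fromSpecStalk s = Spec.map (X.presheaf.stalkCongr (.of_eq hx)).hom ≫ X.fromSpecStalk (π (q w))
    rw [TopCat.Presheaf.stalkCongr_hom, Scheme.SpecMap_stalkSpecializes_fromSpecStalk]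
  obtain ⟨χ₀, h1, hloc, -⟩ := exists_stalk_ringHom_of_chart π (q w) φ' q w rfl hsq
  -- read the compatibility at `s`
  have h1' : ∀ a : X.presheaf.stalk s,
      χ₀ (chartBase c j a) = (π.stalkMap (q w)).hom ((X.presheaf.stalkCongr (.of_eq hx.symm)).hom a) := by
    intro a
    rw [← h1 ((X.presheaf.stalkCongr (.of_eq hx.symm)).hom a)]
    change χ₀ (chartBase c j a) = χ₀ (chartBase c j (ι₁.hom ((X.presheaf.stalkCongr (.of_eq hx.symm)).hom a)))
    rw [show ι₁.hom ((X.presheaf.stalkCongr (.of_eq hx.symm)).hom a) = a from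
      stalkCongr_hom_stalkCongr_hom_apply X.presheaf (.of_eq hx.symm) (.of_eq hx) a]
  -- transport the presentation along `ε : B_j ≃ 𝒪_{X,s}[J_s/c_j]`
  have hmem𝔔 : ∀ b, b ∈ 𝔔.asIdeal ↔ ε.symm b ∈ w.asIdeal := fun b => by
    rw [← hmemw, RingEquiv.apply_symm_apply]
  have hεbase : ∀ a, ε.symm (algebraMap _ (blowupAlgebra (Ideal.span (Set.range c)) (c j)) a) = chartBase c j a := by
    intro a
    rw [← hε, RingEquiv.symm_apply_apply]
  obtain ⟨χ, hχ⟩ : ∃ χ : blowupAlgebra (Ideal.span (Set.range c)) (c j) →+* X'.presheaf.stalk (q w),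
      ∀ b, χ b = χ₀ (ε.symm b) := ⟨χ₀.comp ε.symm.toRingHom, fun b => rfl⟩
  have hU : ∀ y : w.asIdeal.primeCompl, IsUnit (χ₀ y) := fun y =>
    @IsLocalization.map_units _ _ w.asIdeal.primeCompl _ _ χ₀.toAlgebra hloc y
  have hS : ∀ z : X'.presheaf.stalk (q w), ∃ x : chartRing c j × w.asIdeal.primeCompl, z * χ₀ x.2 = χ₀ x.1 :=
    fun z => @IsLocalization.surj _ _ w.asIdeal.primeCompl _ _ χ₀.toAlgebra hloc z
  have hE : ∀ {x y : chartRing c j}, χ₀ x = χ₀ y → ∃ d : w.asIdeal.primeCompl, (d : chartRing c j) * x = d * y :=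
    fun {x y} h => @IsLocalization.exists_of_eq _ _ w.asIdeal.primeCompl _ _ χ₀.toAlgebra hloc x y h
  have hmemε : ∀ b₀ : chartRing c j, ε b₀ ∈ 𝔔.asIdeal ↔ b₀ ∈ w.asIdeal := hmemw
  have hLM : 𝔔.asIdeal.primeCompl.IsLocalizationMap (χ : _ → X'.presheaf.stalk (q w)) :=
    { map_units := fun y => by
        have hy' : ε.symm (y : blowupAlgebra (Ideal.span (Set.range c)) (c j)) ∈ w.asIdeal.primeCompl :=
          fun h => y.2 ((hmem𝔔 _).mpr h)
        have hu := hU ⟨_, hy'⟩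
        rwa [← hχ] at hu
      surj := fun z => by
        obtain ⟨⟨x₀, ⟨y₀, hy₀⟩⟩, hz⟩ := hS z
        have hy : ε y₀ ∈ 𝔔.asIdeal.primeCompl := fun h => hy₀ ((hmemε y₀).mp h)
        refine ⟨⟨ε x₀, ⟨ε y₀, hy⟩⟩, ?_⟩
        have e1 : χ (ε y₀) = χ₀ y₀ := by rw [hχ, RingEquiv.symm_apply_apply]
        have e2 : χ (ε x₀) = χ₀ x₀ := by rw [hχ, RingEquiv.symm_apply_apply]
        simpa only [e1, e2] using hz
      exists_of_eq := fun {x y} hxy => by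
        rw [hχ, hχ] at hxy
        obtain ⟨⟨d₀, hd₀⟩, hd⟩ := hE hxy
        have hd' : ε d₀ ∈ 𝔔.asIdeal.primeCompl := fun h => hd₀ ((hmemε d₀).mp h)
        refine ⟨⟨ε d₀, hd'⟩, ε.symm.injective ?_⟩
        simpa only [map_mul, RingEquiv.symm_apply_apply] using hd }
  letI := χ.toAlgebra
  haveI : IsLocalization.AtPrime (X'.presheaf.stalk (q w)) 𝔔.asIdeal :=
    (isLocalization_iff_isLocalizationMap _ _).mpr hLM
  let e : X'.presheaf.stalk (q w) ≃ₐ[blowupAlgebra (Ideal.span (Set.range c)) (c j)] Localization.AtPrime 𝔔.asIdeal :=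
    IsLocalization.algEquiv 𝔔.asIdeal.primeCompl _ _
  refine ⟨q w, hx, χ, e.toRingEquiv, fun a => ?_, fun b => e.commutes b⟩
  rw [hχ, hεbase]
  exact h1' a

/-- **In a fixed chart the prime is determined by the point.** Let `π : X' → X` be a blowing up along `J`, `x' ∈ X'` with
`π x' = s`, `c` generators of `J_s`, and `(j, 𝔔₁, χ₁)`, `(j, 𝔔₂, χ₂)` two presentations of `𝒪_{X',x'}` as a localization of the
SAME chart algebra `𝒪_{X,s}[J_s/c_j]` (`χᵢ` a localization map at `𝔔ᵢ`) which agree with `π^♯_{x'}` on `𝒪_{X,s}`. Then `𝔔₁ = 𝔔₂`.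
(The image of `c_j` generates the exceptional ideal `(J·𝒪_{X'})_{x'}`, which is generated by a non-zero-divisor
(`IsBlowup.isEffectiveCartier`), so it is a non-zero-divisor; hence `χ₁ = χ₂` on the fractions `c_l/c_j`, so on the whole chart
algebra, and `𝔔ᵢ = χᵢ⁻¹(𝔪_{x'})`.) [cite: StacksProject, Tag 0804] -/
theorem chartPrime_eq_of_presentations (hπ : IsBlowup π J) (x' : X') {s : X} (hx : π x' = s) {k : ℕ}
    (c : Fin k → X.presheaf.stalk s) (hc : Ideal.span (Set.range c) = stalkIdeal J s) (j : Fin k)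
    (𝔔₁ 𝔔₂ : PrimeSpectrum (blowupAlgebra (Ideal.span (Set.range c)) (c j)))
    (χ₁ χ₂ : blowupAlgebra (Ideal.span (Set.range c)) (c j) →+* X'.presheaf.stalk x')
    (hχ₁ : ∀ a, χ₁ (algebraMap _ _ a) = (π.stalkMap x').hom ((X.presheaf.stalkCongr (.of_eq hx.symm)).hom a))
    (hχ₂ : ∀ a, χ₂ (algebraMap _ _ a) = (π.stalkMap x').hom ((X.presheaf.stalkCongr (.of_eq hx.symm)).hom a))
    (hloc₁ : @IsLocalization.AtPrime _ _ (X'.presheaf.stalk x') _ χ₁.toAlgebra 𝔔₁.asIdeal _)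
    (hloc₂ : @IsLocalization.AtPrime _ _ (X'.presheaf.stalk x') _ χ₂.toAlgebra 𝔔₂.asIdeal _) : 𝔔₁ = 𝔔₂ := by
  classical
  subst hx
  -- the common structure map `ψ : 𝒪_{X,π x'} → 𝒪_{X',x'}` and the exceptional generator `u = ψ (c j)`
  let ψ : X.presheaf.stalk (π x') →+* X'.presheaf.stalk x' :=
    (π.stalkMap x').hom.comp (X.presheaf.stalkCongr (.of_eq (rfl : π x' = π x').symm)).hom.hom
  have hχ₁' : ∀ a, χ₁ (algebraMap _ (blowupAlgebra (Ideal.span (Set.range c)) (c j)) a) = ψ a := hχ₁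
  have hχ₂' : ∀ a, χ₂ (algebraMap _ (blowupAlgebra (Ideal.span (Set.range c)) (c j)) a) = ψ a := hχ₂
  have hψid : ∀ a, ψ a = (π.stalkMap x').hom a := fun a => by
    change (π.stalkMap x').hom ((X.presheaf.stalkCongr _).hom a) = _
    congr 1
    rw [TopCat.Presheaf.stalkCongr_hom]
    exact stalkSpecializes_self_apply X.presheaf (π x') _ a
  let u : X'.presheaf.stalk x' := ψ (c j)
  have hu : u = ψ (c j) := rfl
  -- the exceptional ideal at `x'` is `(u)`
  have hfrac : ∀ (χ : blowupAlgebra (Ideal.span (Set.range c)) (c j) →+* X'.presheaf.stalk x'),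
      (∀ a, χ (algebraMap _ (blowupAlgebra (Ideal.span (Set.range c)) (c j)) a) = ψ a) → ∀ l : Fin k,
      χ (blowupAlgebra.frac c j l) * u = ψ (c l) := by
    intro χ hχ l
    rw [hu, ← hχ, ← hχ, ← map_mul, blowupAlgebra.frac, blowupAlgebra.gen_mul_algebraMap]
  have hEx : stalkIdeal (J.comap π) x' = Ideal.span {u} := by
    rw [stalkIdeal_comap_eq_map_stalkMap, ← hc, Ideal.map_span, ← Set.range_comp]
    apply le_antisymm
    · refine Ideal.span_le.mpr ?_
      rintro _ ⟨l, rfl⟩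
      rw [Function.comp_apply, ← hψid, ← hfrac χ₁ hχ₁' l, SetLike.mem_coe]
      exact Ideal.mul_mem_left _ _ (Ideal.mem_span_singleton_self u)
    · rw [Ideal.span_singleton_le_iff_mem, hu, hψid]
      exact Ideal.subset_span ⟨j, rfl⟩
  -- `u` is a non-zero-divisor: the exceptional ideal is generated by a non-zero-divisor
  have hunzd : u ∈ nonZeroDivisors (X'.presheaf.stalk x') := by
    obtain ⟨U, hxU, f, hf, hfU⟩ := hπ.isEffectiveCartier x'
    have hgerm : stalkIdeal (J.comap π) x' = Ideal.span {(X'.presheaf.germ U x' hxU).hom f} := by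
      rw [stalkIdeal_eq_map_germ (J.comap π) U hxU, hfU, Ideal.map_span, Set.image_singleton]
    -- the germ of `f` is a non-zero-divisor of the localization `𝒪_{X',x'}` of `Γ(X', U)`
    have hfnzd : (X'.presheaf.germ U x' hxU).hom f ∈ nonZeroDivisors (X'.presheaf.stalk x') := by
      letI := TopCat.Presheaf.algebra_section_stalk X'.presheaf (⟨x', hxU⟩ : (U : X'.Opens))
      haveI := U.2.isLocalization_stalk ⟨x', hxU⟩
      exact IsLocalization.nonZeroDivisors_le_comap (M := (U.2.primeIdealOf ⟨x', hxU⟩).asIdeal.primeCompl)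
        (S := X'.presheaf.stalk x') hf
    rw [hEx] at hgerm
    -- `(u) = (g)` with `g` a non-zero-divisor forces `u` to be one
    obtain ⟨a, ha⟩ := Ideal.mem_span_singleton'.mp (hgerm ▸ Ideal.mem_span_singleton_self u :
      u ∈ Ideal.span {(X'.presheaf.germ U x' hxU).hom f})
    obtain ⟨b, hb⟩ := Ideal.mem_span_singleton'.mp (hgerm.symm ▸ Ideal.mem_span_singleton_self _ :
      (X'.presheaf.germ U x' hxU).hom f ∈ Ideal.span {u})
    -- `u = a g`, `g = b u` ⇒ `g = b a g` ⇒ `(1 - b a) g = 0` ⇒ `b a = 1`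
    have hab : b * a = 1 := by
      have h0 : (1 - b * a) * (X'.presheaf.germ U x' hxU).hom f = 0 := by
        rw [sub_mul, one_mul, mul_assoc, ha, hb, sub_self]
      have := (mem_nonZeroDivisors_iff.mp hfnzd).2 _ h0
      exact (sub_eq_zero.mp this).symm
    rw [← ha]
    exact mul_mem (IsUnit.mem_nonZeroDivisors (IsUnit.of_mul_eq_one_right b hab)) hfnzd
  -- `χ₁ = χ₂` on the fractions, hence everywhere
  have hfr : ∀ l : Fin k, χ₁ (blowupAlgebra.frac c j l) = χ₂ (blowupAlgebra.frac c j l) := fun l =>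
    (mul_cancel_right_mem_nonZeroDivisors hunzd).mp ((hfrac χ₁ hχ₁' l).trans (hfrac χ₂ hχ₂' l).symm)
  have heq : χ₁ = χ₂ := by
    have hcomp : χ₁.comp (blowupAlgebra.eval c j).toRingHom = χ₂.comp (blowupAlgebra.eval c j).toRingHom := by
      refine MvPolynomial.ringHom_ext (fun r => ?_) (fun l => ?_)
      · simp only [RingHom.comp_apply, AlgHom.toRingHom_eq_coe, RingHom.coe_coe, blowupAlgebra.eval_C]
        rw [hχ₁', hχ₂']
      · simp only [RingHom.comp_apply, AlgHom.toRingHom_eq_coe, RingHom.coe_coe, blowupAlgebra.eval_X, hfr]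
    refine RingHom.ext fun b => ?_
    obtain ⟨p, rfl⟩ := blowupAlgebra.eval_surjective c j b
    exact RingHom.congr_fun hcomp p
  -- `𝔔ᵢ = χᵢ⁻¹ 𝔪_{x'}`
  apply PrimeSpectrum.ext
  ext b
  rw [← @IsLocalization.AtPrime.to_map_mem_maximal_iff _ _ (X'.presheaf.stalk x') _ χ₁.toAlgebra 𝔔₁.asIdeal _ hloc₁ b,
    ← @IsLocalization.AtPrime.to_map_mem_maximal_iff _ _ (X'.presheaf.stalk x') _ χ₂.toAlgebra 𝔔₂.asIdeal _ hloc₂ b]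
  change χ₁ b ∈ maximalIdeal (X'.presheaf.stalk x') ↔ χ₂ b ∈ maximalIdeal (X'.presheaf.stalk x')
  rw [heq]

end Summit.ResolutionOfSingularities.ResolutionOfSingularities.Cruxes.EquisingularLiftNat.Sections

end
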